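import Summits.NavierStokesRegularity.FluidComputer.BlockControl
import Summits.NavierStokesRegularity.NavierStokesRegularity.Theorems.FluidComputerArchitecture
import HarnessLib

/-!
# Fourier-block design, VI: the design plugged into the shadowed-circuit architecture (summit corollaries)

HONEST FRAMING (cell `pub-fluidc`, verbatim): *low prior, high value-of-information experiment on
Tao's machine paradigm; NOT a claim that NS blows up.*

`Summits/NavierStokesRegularity/FluidComputer/Block{Junk,Readout,Handoff,Statics,Control}.lean`
construct a CONCRETE instance of every static field of the architecture
`Literature.Analysis.FluidPDE.FluidComputer.ShadowedCircuit` (readout, reconstruction, junk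
functional, gate windows, Lipschitz/identifiability/junk certificates, core thickening, energy floor,
hand-off with coarse-content erasure, seed) for a two-wavelet Fourier-block design, and isolate what
is NOT constructed — the finite-dimensional circuit, its clock and the two dynamical axioms
`shadow` ∧ `leak` for the true Navier–Stokes mild flow — as the residual structure
`BlockDesign.Dynamics 𝒟 P`. This file records the resulting implications for the Clay statement:

* `ns_blowup_of_blockDynamics` : an inhabitant of `BlockDesign.Dynamics 𝒟 P` (any admissible
  parameters, `α > 0`, `η > 1/4`) refutes `NavierStokesRegularity`; `ns_blowup_of_stdBlockDynamics` :
  the same for the certified standard parameters `BlockDesign.Params.std` (`s = 10`, `μ = 1`,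
  `[aLo,aHi] = [3/2,2]`, `c₀ = σsp = 1/4`, `δ = 1/2`, `jcore = 1/5 < jin = 1/2 < jrun = 1`), whose
  budget inequalities are theorems — so for these parameters the ONLY hypotheses left are the
  `Dynamics` fields;
* `stableBlowup_of_blockDynamics`, `stableBlowup_H10ball_of_stdBlockDynamics` : the blow-up is
  stable (radius computed from the design margins);
* `live_of_blockDynamics`, `energy_reaches_all_scales_of_blockDynamics` : with a bounded circuit tube
  the design is LIVE unconditionally in the mild `H¹⁰` theory (`BlockDesign.Dynamics.h10Control`),
  hence the cascade theorem holds along the seed's maximal trajectory.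

Burden NOT lowered: `Dynamics.shadow` ∧ `Dynamics.leak` for the true equations are IDEA-BOUND (Tao's
open programme); for the bare two-wavelet design they are presumably FALSE as stated (a real pump
needs the inert conduit machinery of [Tao2016, §§5–6]); what this file certifies is only that
nothing ELSE is missing.
-/

noncomputable section

open Set Filter Topology Metric
open scoped SchwartzMap ENNReal BigOperators

namespace Summit.NavierStokesRegularity.FluidComputer.BlockDesign

open Literature.Analysis.FluidPDE Literature.Analysis.FluidPDE.Tao2016
open Literature.Analysis.FluidPDE.FluidComputer
open Literature.Analysis.FunctionSpaces (eFourierSobolevNorm)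
open Summit.NavierStokesRegularity.NavierStokesRegularity.Theorems.FluidComputer

variable {𝒟 : CascadeWaveletData 1 1} {S : CascadeSpecs} {P : Params S}

/-! ### Blow-up -/

/-- **A circuit + clock + shadowing for the Fourier-block design refutes Clay (A)** (`α > 0`,
`η > 1/4`): every static field of the architecture is supplied by the block design, so an inhabitant
of the residual structure `BlockDesign.Dynamics 𝒟 P` is a full `ShadowedCircuit`. HONEST FRAMING: an
implication from a structure not known to be inhabited; NOT a claim that NS blows up. -/
theorem ns_blowup_of_blockDynamics (Dy : Dynamics 𝒟 P) (hα : 0 < S.alpha) (hη : 1 / 4 < S.eta) :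
    ¬ NavierStokesRegularity :=
  ns_blowup_of_shadowedCircuit Dy.toShadowedCircuit hα hη

/-- **The same for the certified standard parameters** `Params.std` (`λ₀ = 1`, `η > 1/4`): all budget
inequalities of the design are theorems (`BlockStatics`), so the hypotheses are exactly a wavelet
datum `𝒟`, the two spec inequalities, and the `Dynamics` fields. -/
theorem ns_blowup_of_stdBlockDynamics (hS : S.lam0 = 1) (hα : 0 < S.alpha) (hη : 1 / 4 < S.eta)
    (Dy : Dynamics 𝒟 (Params.std S hS hη)) : ¬ NavierStokesRegularity :=
  ns_blowup_of_blockDynamics Dy hα hη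

/-- The hypotheses of `ns_blowup_of_stdBlockDynamics` other than `Dynamics` are jointly satisfiable:
a wavelet datum exists and `λ₀ = 1`, `α = 1`, `η = 1/2` is an admissible spec. [folklore] -/
theorem stdBlock_hypotheses_inhabited :
    ∃ (_ : CascadeWaveletData 1 1) (S : CascadeSpecs), S.lam0 = 1 ∧ 0 < S.alpha ∧ 1 / 4 < S.eta := by
  obtain ⟨𝒟⟩ := nonempty_design
  exact ⟨𝒟, ⟨1, 1, 1, 1, 1 / 2, one_pos, one_pos, one_pos, by norm_num, by norm_num⟩, rfl, one_pos,
    by norm_num⟩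

/-! ### Stability -/

/-- **Stable blow-up for the block design**: every divergence-free Schwartz datum within
`X^s_{λ₀}`-distance `ρ √E₀` of the seed `aLo √E₀ ψ₀` (`ρ = min (δ/Λ) (jin - jcore)`) has all its
`H¹⁰_df`-mild Navier–Stokes trajectories of lifespan `≤ T_*`. -/
theorem stableBlowup_of_blockDynamics (Dy : Dynamics 𝒟 P) (hα : 0 < S.alpha) (hη : 1 / 4 < S.eta)
    (w₀ : 𝓢(EuclideanSpace ℝ (Fin 3), EuclideanSpace ℝ (Fin 3)))
    (hdiv : VectorCalculus.IsDivFree ⇑w₀)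
    (hnear : scaledSobolevNorm P.s (S.lam 0) (schwartzL2 w₀ - schwartzL2 (seed 𝒟 P)) <
      ENNReal.ofReal (Dy.toShadowedCircuit.rho * Real.sqrt (S.Emin 0)))
    {S' : ℝ} {u : ℝ → L2C} (hu : IsMildSolutionFor eulerForm (schwartzL2 w₀) (Ico 0 S') u) :
    S' ≤ S.Tstar :=
  stableBlowup_of_shadowedCircuit Dy.toShadowedCircuit P.s_nonneg hα hη w₀ hdiv hnear hu

/-- **Stable blow-up on an `H¹⁰`-ball around the seed, standard parameters** (`s = 10`, `λ₀ = 1`). -/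
theorem stableBlowup_H10ball_of_stdBlockDynamics (hS : S.lam0 = 1) (hα : 0 < S.alpha)
    (hη : 1 / 4 < S.eta) (Dy : Dynamics 𝒟 (Params.std S hS hη))
    (w₀ : 𝓢(EuclideanSpace ℝ (Fin 3), EuclideanSpace ℝ (Fin 3)))
    (hdiv : VectorCalculus.IsDivFree ⇑w₀)
    (hnear : eFourierSobolevNorm 10 (schwartzL2 w₀ - schwartzL2 (seed 𝒟 (Params.std S hS hη))) <
      ENNReal.ofReal (Dy.toShadowedCircuit.rho * Real.sqrt (S.Emin 0)))
    {S' : ℝ} {u : ℝ → L2C} (hu : IsMildSolutionFor eulerForm (schwartzL2 w₀) (Ico 0 S') u) :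
    S' ≤ S.Tstar :=
  stableBlowup_H10ball_of_shadowedCircuit Dy.toShadowedCircuit (by norm_num [Params.std])
    (by norm_num [Params.std]) (by rw [hS]) hα hη w₀ hdiv hnear hu

/-! ### Liveness and the cascade theorem -/

/-- **The block design with a bounded circuit tube is LIVE, unconditionally in the mild theory**
(`s ≥ 10`, `μ > 0`): `H10Control` is a theorem for this design (`Dynamics.h10Control`) and
`H10MildTheory` is a theorem for the true equations. -/
theorem live_of_blockDynamics (Dy : Dynamics 𝒟 P) (hs : 10 ≤ P.s) (hμ : 0 < P.μ)
    (hT : ∃ R : ℝ, ∀ p ∈ Ain P, ∀ σ : ℝ, 0 ≤ σ → σ ≤ Dy.τc → ‖Dy.Φ σ p‖ ≤ R) :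
    Dy.toShadowedCircuit.toPumpCascade.Live :=
  live_of_shadowedCircuit Dy.toShadowedCircuit (Dy.h10Control hs hμ hT)

/-- **THE CASCADE THEOREM for the block design** (bounded tube, `s ≥ 10`, `μ > 0`, `α > 0`,
`η > 1/4`): along the seed's maximal `H¹⁰_df`-mild trajectory every generation's energy `E_n` is
present at frequency `≥ 2ⁿ` at a clocked instant `t_n < S_m ≤ T_*`, and the `H¹⁰` norm is unbounded
on `[0, S_m)`. -/
theorem energy_reaches_all_scales_of_blockDynamics (Dy : Dynamics 𝒟 P) (hs : 10 ≤ P.s)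
    (hμ : 0 < P.μ) (hT : ∃ R : ℝ, ∀ p ∈ Ain P, ∀ σ : ℝ, 0 ≤ σ → σ ≤ Dy.τc → ‖Dy.Φ σ p‖ ≤ R)
    (hα : 0 < S.alpha) (hη : 1 / 4 < S.eta) :
    ∃ Sm : ℝ, 0 < Sm ∧ Sm ≤ S.Tstar ∧ ∃ U : ℝ → L2C,
      IsMildSolutionFor eulerForm (schwartzL2 (seed 𝒟 P)) (Ico 0 Sm) U ∧
      (∀ C : ℝ, ∃ s ∈ Ico 0 Sm, ENNReal.ofReal C < eFourierSobolevNorm 10 (U s)) ∧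
      ∃ t : ℕ → ℝ, t 0 = 0 ∧ Monotone t ∧
        ∀ n, t n < Sm ∧ t n ≤ ∑ k ∈ Finset.range n, S.Tmax k ∧
          ENNReal.ofReal (S.Emin n) ≤ highFreqEnergy (S.lam n) (U (t n)) :=
  energy_reaches_all_scales_of_shadowedCircuit Dy.toShadowedCircuit hα hη (Dy.h10Control hs hμ hT)

/-- Standard parameters: liveness needs only the bounded tube. -/
theorem live_of_stdBlockDynamics (hS : S.lam0 = 1) (hη : 1 / 4 < S.eta)
    (Dy : Dynamics 𝒟 (Params.std S hS hη))
    (hT : ∃ R : ℝ, ∀ p ∈ Ain (Params.std S hS hη), ∀ σ : ℝ, 0 ≤ σ → σ ≤ Dy.τc → ‖Dy.Φ σ p‖ ≤ R) :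
    Dy.toShadowedCircuit.toPumpCascade.Live :=
  live_of_blockDynamics Dy (by norm_num [Params.std]) (by norm_num [Params.std]) hT

end Summit.NavierStokesRegularity.FluidComputer.BlockDesign

end
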